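import Summits.HubbardSuperconductivity.HubbardSuperconductivity.Theorems.BalabanIRBirEveryGroundStateUniqueGroundClosers

/-!
# Route `BalabanIR`, crux 5 `BirEveryGroundState` (`stmt-HubbardSuperconductivity-2083`):
# the line `spectral-curve-anchor` AUDITED, III — the lead's RESHAPED second stub

Theses-free companion of `BalabanIRBirEveryGroundStateUniqueGround(Closers).lean`. After wave 1 the
line lead weakened `stub_noJointEigenGround` to exactly what the composition consumes: eventually in
even `L`, for every `γ`, NOT ALL sector ground states are doublon eigenvectors with the common
eigenvalue `γ` (skeleton `Cruxes/BirEveryGroundState/Lines/spectral_curve_anchor.lean`, 2026-08-16).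
The audit is unchanged by the reshape:

* `UniqueGround.exists_common_eigenvalue_of_forall_eigenvector` — a subspace all of whose nonzero
  vectors are eigenvectors of a matrix `D` carries ONE common eigenvalue (linear algebra);
* `finrankOne_or_exists_forall_joint_of_anchoredOrLinear` — so at a coupling non-exceptional for
  the side `L` the dichotomy of `stub_groundSheetAnchored` gives `dim E₀(U, L) = 1` or a COMMON
  doublon eigenvalue on the whole sector ground eigenspace (sharpening
  `finrankOne_or_forall_joint_of_anchoredOrLinear`);
* `uniqueGroundUnderAvg_of_reshapedSpectralCurveStubs` — `stub_groundSheetAnchored` together with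
  the RESHAPED `stub_noJointEigenGround` (both verbatim, as hypotheses) still imply the curve-free
  residual UNIQUE GROUND STATES UNDER THE AVERAGE BOUND, and
* `birEveryGroundState_structural_of_reshapedSpectralCurveStubs` — hence the body of the item
  (the reshaped line's THESES-FREE closer, via
  `birEveryGroundState_structural_of_uniqueGroundUnderAvg`).

Nothing here proves either open stub. Kato (1966) Ch. II §1.1; Lieb, PRL 62 (1989) 1201.
Folklore; no definition is introduced.
-/

noncomputable section

namespace Summit.HubbardSuperconductivity.HubbardSuperconductivity.Theorems

open Polynomial Matrix Finset Filter
open scoped Polynomial ComplexOrder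
open Literature.Probability.LatticeModels Literature.MathematicalPhysics.QuantumLattice
open Literature.Computability.AlgebraicComplexity

namespace UniqueGround

/-- **All nonzero vectors eigenvectors ⇒ one common eigenvalue.** If every nonzero vector of a
subspace `E` is an eigenvector of the matrix `D`, then `D` acts on `E` as ONE scalar (two
eigenvalues `γ₀ ≠ γ₁` on `ψ₀, ψ ∈ E` are refuted by the eigenvector `ψ₀ + ψ`). [folklore] -/
theorem exists_common_eigenvalue_of_forall_eigenvector {n : Type} [Fintype n] [DecidableEq n]
    (E : Submodule ℂ (n → ℂ)) (D : Matrix n n ℂ)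
    (h : ∀ ψ ∈ E, ψ ≠ 0 → ∃ γ : ℂ, D *ᵥ ψ = γ • ψ) :
    ∃ γ : ℂ, ∀ ψ ∈ E, D *ᵥ ψ = γ • ψ := by
  by_cases hE : ∀ ψ ∈ E, ψ = 0
  · exact ⟨0, fun ψ hψ => by rw [hE ψ hψ, mulVec_zero, smul_zero]⟩
  push Not at hE
  obtain ⟨ψ₀, hψ₀E, hψ₀⟩ := hE
  obtain ⟨γ₀, hγ₀⟩ := h ψ₀ hψ₀E hψ₀
  refine ⟨γ₀, fun ψ hψE => ?_⟩
  by_cases hψ : ψ = 0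
  · rw [hψ, mulVec_zero, smul_zero]
  obtain ⟨γ₁, hγ₁⟩ := h ψ hψE hψ
  by_cases heq : γ₁ = γ₀
  · rw [hγ₁, heq]
  exfalso
  have hsumE : ψ₀ + ψ ∈ E := E.add_mem hψ₀E hψE
  by_cases hsum : ψ₀ + ψ = 0
  · -- `ψ = -ψ₀` is a `γ₀`-eigenvector
    have hψeq : ψ = -ψ₀ := eq_neg_of_add_eq_zero_right hsum
    have h2 : γ₁ • ψ = γ₀ • ψ := by
      rw [← hγ₁, hψeq, mulVec_neg, hγ₀, smul_neg]
    have h3 : (γ₁ - γ₀) • ψ = 0 := by rw [sub_smul, h2, sub_self]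
    rcases smul_eq_zero.mp h3 with h0 | h0
    · exact heq (sub_eq_zero.mp h0)
    · exact hψ h0
  obtain ⟨γ₂, hγ₂⟩ := h _ hsumE hsum
  have h1 : γ₂ • ψ₀ + γ₂ • ψ = γ₀ • ψ₀ + γ₁ • ψ := by
    rw [← smul_add, ← hγ₂, mulVec_add, hγ₀, hγ₁]
  have key : (γ₀ - γ₂) • ψ₀ + (γ₁ - γ₂) • ψ = 0 := by
    calc (γ₀ - γ₂) • ψ₀ + (γ₁ - γ₂) • ψ
        = (γ₀ • ψ₀ + γ₁ • ψ) - (γ₂ • ψ₀ + γ₂ • ψ) := by simp only [sub_smul]; abel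
      _ = 0 := by rw [h1, sub_self]
  by_cases h02 : γ₀ = γ₂
  · have h3 : (γ₁ - γ₂) • ψ = 0 := by
      rw [h02, sub_self, zero_smul, zero_add] at key
      exact key
    rcases smul_eq_zero.mp h3 with h0 | h0
    · exact heq ((sub_eq_zero.mp h0).trans h02.symm)
    · exact hψ h0
  · have hne02 : γ₀ - γ₂ ≠ 0 := sub_ne_zero.mpr h02
    have hsm : (γ₀ - γ₂) • ψ₀ = -((γ₁ - γ₂) • ψ) := eq_neg_of_add_eq_zero_left key
    have hψ₀eq : ψ₀ = (γ₀ - γ₂)⁻¹ • (-((γ₁ - γ₂) • ψ)) := by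
      rw [← hsm, smul_smul, inv_mul_cancel₀ hne02, one_smul]
    have hD0 : D *ᵥ ψ₀ = γ₁ • ψ₀ := by
      rw [hψ₀eq, mulVec_smul, mulVec_neg, mulVec_smul, hγ₁]
      simp only [smul_neg, smul_smul, neg_inj]
      congr 1
      ring
    have h3 : (γ₁ - γ₀) • ψ₀ = 0 := by rw [sub_smul, ← hD0, hγ₀, sub_self]
    rcases smul_eq_zero.mp h3 with h0 | h0
    · exact heq (sub_eq_zero.mp h0)
    · exact hψ₀ h0

end UniqueGround

open UniqueGround

/-- **Anchored-or-linear ⇒ simple or ONE common doublon eigenvalue** (one side `L`, one sector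
`szSector (2m) 0`, at a coupling `U` non-exceptional for the side `L`; sharpening of
`finrankOne_or_forall_joint_of_anchoredOrLinear`): under the dichotomy of `stub_groundSheetAnchored`
the sector ground eigenspace is one-dimensional, or ALL sector ground states are eigenvectors of
the doublon number with a COMMON eigenvalue (`UniqueGround.exists_common_eigenvalue_of_forall_eigenvector`
applied to `E₀`, whose nonzero vectors are exactly the sector ground states). [folklore] -/
theorem finrankOne_or_exists_forall_joint_of_anchoredOrLinear (L : ℕ) [NeZero L] (m : ℕ) (U : ℝ)
    (hmax : ∀ u' : ℝ, (hubbardTorus 2 L 1 u').charpoly.roots.toFinset.card ≤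
      (hubbardTorus 2 L 1 U).charpoly.roots.toFinset.card)
    (hdich :
      let T := hubbardTorus 2 L 1 0
      let D : Matrix (Finset (Orb (FermionTorus 2 L))) (Finset (Orb (FermionTorus 2 L))) ℂ :=
        ∑ x : FermionTorus 2 L, numberOp x 0 * numberOp x 1
      let S := szSector (Λ := FermionTorus 2 L) (2 * m) 0
      let e₀ : ℝ := (hubbardTorus 2 L 1 U).minEnergyOn S
      ∀ χ : ℂ[X][X], χ.Monic →
        (∀ u μ : ℂ, (χ.map (evalRingHom u)).IsRoot μ ↔ ∃ v ∈ S, v ≠ 0 ∧ (T + u • D) *ᵥ v = μ • v) →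
        (∀ u μ : ℝ, (χ.map (evalRingHom (u : ℂ))).rootMultiplicity (μ : ℂ) =
          Module.finrank ℂ ↥(S ⊓ Module.End.eigenspace (Matrix.toLin' (T + (u : ℂ) • D)) (μ : ℂ))) →
        ∀ p : ℂ[X][X], Irreducible p → p ∣ χ → (p.map (evalRingHom (U : ℂ))).IsRoot ((e₀ : ℝ) : ℂ) →
          (∃ U₀ μ₀ : ℂ, (p.map (evalRingHom U₀)).IsRoot μ₀ ∧
            (χ.map (evalRingHom U₀)).rootMultiplicity μ₀ = 1) ∨
          (∃ ε γ : ℂ, (X - C (C ε + C γ * X)) ∣ χ ∧ ((e₀ : ℝ) : ℂ) = ε + γ * (U : ℂ))) :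
    let H := hubbardTorus 2 L 1 U
    let S := szSector (Λ := FermionTorus 2 L) (2 * m) 0
    let E₀ := S ⊓ Module.End.eigenspace (Matrix.toLin' H) ((H.minEnergyOn S : ℝ) : ℂ)
    Module.finrank ℂ E₀ = 1 ∨
      ∃ γ : ℂ, ∀ ψ : Fock (Orb (FermionTorus 2 L)), IsGroundStateInSector H (2 * m) 0 ψ →
        (∑ x : FermionTorus 2 L, numberOp x 0 * numberOp x 1 :
          Matrix (Finset (Orb (FermionTorus 2 L))) (Finset (Orb (FermionTorus 2 L))) ℂ) *ᵥ ψ =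
            γ • ψ := by
  set D : Matrix (Finset (Orb (FermionTorus 2 L))) (Finset (Orb (FermionTorus 2 L))) ℂ :=
    ∑ x : FermionTorus 2 L, numberOp x 0 * numberOp x 1 with hD
  set S : Submodule ℂ (Fock (Orb (FermionTorus 2 L))) :=
    szSector (Λ := FermionTorus 2 L) (2 * m) 0 with hS
  set H : Matrix (Finset (Orb (FermionTorus 2 L))) (Finset (Orb (FermionTorus 2 L))) ℂ :=
    hubbardTorus 2 L 1 U with hH
  set E₀ : Submodule ℂ (Fock (Orb (FermionTorus 2 L))) :=
    S ⊓ Module.End.eigenspace (Matrix.toLin' H) ((H.minEnergyOn S : ℝ) : ℂ) with hE₀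
  have h := finrankOne_or_forall_joint_of_anchoredOrLinear L m U hmax hdich
  simp only at h ⊢
  refine h.imp_right fun hall => ?_
  -- the nonzero vectors of `E₀` are exactly the sector ground states
  have hmem : ∀ ψ : Fock (Orb (FermionTorus 2 L)),
      IsGroundStateInSector H (2 * m) 0 ψ ↔ ψ ∈ E₀ ∧ ψ ≠ 0 := by
    intro ψ
    constructor
    · rintro ⟨hψS, hψ0, hHψ⟩
      refine ⟨Submodule.mem_inf.mpr ⟨hψS, ?_⟩, hψ0⟩
      rw [Module.End.mem_eigenspace_iff, Matrix.toLin'_apply]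
      exact hHψ
    · rintro ⟨hψE, hψ0⟩
      obtain ⟨hψS, hψeig⟩ := Submodule.mem_inf.mp hψE
      rw [Module.End.mem_eigenspace_iff, Matrix.toLin'_apply] at hψeig
      exact ⟨hψS, hψ0, hψeig⟩
  obtain ⟨γ, hγ⟩ := exists_common_eigenvalue_of_forall_eigenvector E₀ D
    fun ψ hψE hψ0 => hall ψ ((hmem ψ).2 ⟨hψE, hψ0⟩)
  exact ⟨γ, fun ψ hgs => hγ ψ ((hmem ψ).1 hgs).1⟩

/-- **The RESHAPED open stubs of line `spectral-curve-anchor` imply UNIQUE GROUND STATES UNDER THE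
AVERAGE BOUND.** `hanch` = `stub_groundSheetAnchored`, `hnoj` = the lead's reshaped
`stub_noJointEigenGround` (eventually, for every `γ`, not all sector ground states are doublon
eigenvectors with eigenvalue `γ`), both verbatim and both OPEN; conclusion: at every coupling
`U > 0` non-exceptional for all sides, the eventual average bound forces eventually `dim E₀ = 1`
(`finrankOne_or_exists_forall_joint_of_anchoredOrLinear` side by side). [folklore] -/
theorem uniqueGroundUnderAvg_of_reshapedSpectralCurveStubs (hanch : ∀ δ ∈ Set.Ioo (0:ℝ) (1/2), ∀ U : ℝ, 0 < U → (∀ (L : ℕ) (u' : ℝ), (hubbardTorus 2 L 1 u').charpoly.roots.toFinset.card ≤ (hubbardTorus 2 L 1 U).charpoly.roots.toFinset.card) → ∀ c : ℝ, 0 < c → (∃ L₀ : ℕ, ∀ (L : ℕ) [NeZero L], L₀ ≤ L → Even L → let N : ℕ := 2 * ⌊(1 - δ) * (L : ℝ) ^ 2 / 2⌋₊; let H := hubbardTorus 2 L 1 U; let S := szSector (Λ := FermionTorus 2 L) N 0; let E₀ := S ⊓ Module.End.eigenspace (Matrix.toLin' H) ((H.minEnergyOn S : ℝ) : ℂ);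 let P := projMatrix (E₀.map (Fock.toEuclidean (ι := Orb (FermionTorus 2 L)) : Fock (Orb (FermionTorus 2 L)) →ₗ[ℂ] EuclideanSpace ℂ (Finset (Orb (FermionTorus 2 L))))); c * (L : ℝ) ^ 4 * P.trace.re ≤ (P * ((pairField dWaveFormFactor L)ᴴ * pairField dWaveFormFactor L)).trace.re) → ∃ L₀ : ℕ, ∀ (L : ℕ) [NeZero L], L₀ ≤ L → Even L → let N : ℕ := 2 * ⌊(1 - δ) * (L : ℝ) ^ 2 / 2⌋₊; let T := hubbardTorus 2 L 1 0; let D : Matrix (Finset (Orb (FermionTorus 2 L))) (Finset (Orb (FermionTorus 2 L))) ℂ := ∑ x : FermionTorus 2 L, numberOp x 0 * numberOp x 1; let S := szSector (Λ := FermionTorus 2 L) N 0; let e₀ : ℝ := (hubbardTorus 2 L 1 U).minEnergyOn S; ∀ χ : ℂ[X][X], χ.Monic → (∀ u μ : ℂ, (χ.map (evalRingHom u)).IsRoot μ ↔ ∃ v ∈ S, v ≠ 0 ∧ (T + u • D) *ᵥ v = μ • v) → (∀ u μ : ℝ, (χ.map (evalRingHom (u : ℂ))).rootMultiplicity (μ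 : ℂ) = Module.finrank ℂ ↥(S ⊓ Module.End.eigenspace (Matrix.toLin' (T + (u : ℂ) • D)) (μ : ℂ))) → ∀ p : ℂ[X][X], Irreducible p → p ∣ χ → (p.map (evalRingHom (U : ℂ))).IsRoot ((e₀ : ℝ) : ℂ) → (∃ U₀ μ₀ : ℂ, (p.map (evalRingHom U₀)).IsRoot μ₀ ∧ (χ.map (evalRingHom U₀)).rootMultiplicity μ₀ = 1) ∨ (∃ ε γ : ℂ, (X - C (C ε + C γ * X)) ∣ χ ∧ ((e₀ : ℝ) : ℂ) = ε + γ * (U : ℂ))) (hnoj : ∀ δ ∈ Set.Ioo (0:ℝ) (1/2), ∀ U : ℝ, 0 < U → (∀ (L : ℕ) (u' : ℝ), (hubbardTorus 2 L 1 u').charpoly.roots.toFinset.card ≤ (hubbardTorus 2 L 1 U).charpoly.roots.toFinset.card) → ∀ c : ℝ, 0 < c → (∃ L₀ : ℕ, ∀ (L : ℕ) [NeZero L], L₀ ≤ L → Even L → let N : ℕ := 2 * ⌊(1 - δ) * (L : ℝ) ^ 2 / 2⌋₊; let H := hubbardTorus 2 L 1 U; let S := szSector (Λ := FermionTorus 2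 L) N 0; let E₀ := S ⊓ Module.End.eigenspace (Matrix.toLin' H) ((H.minEnergyOn S : ℝ) : ℂ); let P := projMatrix (E₀.map (Fock.toEuclidean (ι := Orb (FermionTorus 2 L)) : Fock (Orb (FermionTorus 2 L)) →ₗ[ℂ] EuclideanSpace ℂ (Finset (Orb (FermionTorus 2 L))))); c * (L : ℝ) ^ 4 * P.trace.re ≤ (P * ((pairField dWaveFormFactor L)ᴴ * pairField dWaveFormFactor L)).trace.re) → ∃ L₀ : ℕ, ∀ (L : ℕ) [NeZero L], L₀ ≤ L → Even L → let N : ℕ := 2 * ⌊(1 - δ) * (L : ℝ) ^ 2 / 2⌋₊; ∀ γ : ℂ, ¬ ∀ ψ : Fock (Orb (FermionTorus 2 L)), IsGroundStateInSector (hubbardTorus 2 L 1 U) N 0 ψ → (∑ x : FermionTorus 2 L, numberOp x 0 * numberOp x 1 : Matrix (Finset (Orb (FermionTorus 2 L))) (Finset (Orb (FermionTorus 2 L))) ℂ) *ᵥ ψ = γ • ψ) : ∀ δ ∈ Set.Ioo (0:ℝ) (1/2), ∀ U : ℝ, 0 < U → (∀ (L : ℕ) (u' : ℝ), (hubbardTorus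 2 L 1 u').charpoly.roots.toFinset.card ≤ (hubbardTorus 2 L 1 U).charpoly.roots.toFinset.card) → ∀ c : ℝ, 0 < c → (∃ L₀ : ℕ, ∀ (L : ℕ) [NeZero L], L₀ ≤ L → Even L → let N : ℕ := 2 * ⌊(1 - δ) * (L : ℝ) ^ 2 / 2⌋₊; let H := hubbardTorus 2 L 1 U; let S := szSector (Λ := FermionTorus 2 L) N 0; let E₀ := S ⊓ Module.End.eigenspace (Matrix.toLin' H) ((H.minEnergyOn S : ℝ) : ℂ); let P := projMatrix (E₀.map (Fock.toEuclidean (ι := Orb (FermionTorus 2 L)) : Fock (Orb (FermionTorus 2 L)) →ₗ[ℂ] EuclideanSpace ℂ (Finset (Orb (FermionTorus 2 L))))); c * (L : ℝ) ^ 4 * P.trace.re ≤ (P * ((pairField dWaveFormFactor L)ᴴ * pairField dWaveFormFactor L)).trace.re) → ∃ L₀ : ℕ, ∀ (L : ℕ) [NeZero L], L₀ ≤ L → Even L → let N : ℕ := 2 * ⌊(1 - δ) * (L : ℝ) ^ 2 / 2⌋₊; let H := hubbardTorus 2 L 1 U; let S := szSector (Λ := FermionTorus 2 L) N 0; let E₀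 := S ⊓ Module.End.eigenspace (Matrix.toLin' H) ((H.minEnergyOn S : ℝ) : ℂ); Module.finrank ℂ E₀ = 1 := by
  intro δ hδ U hU hmax c hc havg
  obtain ⟨L₅, hL₅⟩ := hnoj δ hδ U hU hmax c hc havg
  obtain ⟨L₆, hL₆⟩ := hanch δ hδ U hU hmax c hc havg
  refine ⟨max L₅ L₆, fun L _ hL hLe => ?_⟩
  have hL5 : L₅ ≤ L := (le_max_left _ _).trans hL
  have hL6 : L₆ ≤ L := (le_max_right _ _).trans hL
  set m : ℕ := ⌊(1 - δ) * (L : ℝ) ^ 2 / 2⌋₊ with hm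
  have h6 := hL₆ L hL6 hLe
  have h5 := hL₅ L hL5 hLe
  simp only at h5 h6 ⊢
  rcases finrankOne_or_exists_forall_joint_of_anchoredOrLinear L m U (hmax L) h6 with hfin | ⟨γ, hγ⟩
  · exact hfin
  · exact (h5 γ hγ).elim

/-- **THE RESHAPED LINE'S THESES-FREE CLOSER: `stub_groundSheetAnchored` + reshaped
`stub_noJointEigenGround` ⇒ the body of the item** (composition of
`uniqueGroundUnderAvg_of_reshapedSpectralCurveStubs` with
`birEveryGroundState_structural_of_uniqueGroundUnderAvg`). [folklore] -/
theorem birEveryGroundState_structural_of_reshapedSpectralCurveStubs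
    (hanch : ∀ δ ∈ Set.Ioo (0:ℝ) (1/2), ∀ U : ℝ, 0 < U →
      (∀ (L : ℕ) (u' : ℝ), (hubbardTorus 2 L 1 u').charpoly.roots.toFinset.card ≤
        (hubbardTorus 2 L 1 U).charpoly.roots.toFinset.card) →
      ∀ c : ℝ, 0 < c →
      (∃ L₀ : ℕ, ∀ (L : ℕ) [NeZero L], L₀ ≤ L → Even L →
        let N : ℕ := 2 * ⌊(1 - δ) * (L : ℝ) ^ 2 / 2⌋₊
        let H := hubbardTorus 2 L 1 U
        let S := szSector (Λ := FermionTorus 2 L) N 0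
        let E₀ := S ⊓ Module.End.eigenspace (Matrix.toLin' H) ((H.minEnergyOn S : ℝ) : ℂ)
        let P := projMatrix (E₀.map (Fock.toEuclidean (ι := Orb (FermionTorus 2 L)) :
          Fock (Orb (FermionTorus 2 L)) →ₗ[ℂ] EuclideanSpace ℂ (Finset (Orb (FermionTorus 2 L)))))
        c * (L : ℝ) ^ 4 * P.trace.re ≤
          (P * ((pairField dWaveFormFactor L)ᴴ * pairField dWaveFormFactor L)).trace.re) →
      ∃ L₀ : ℕ, ∀ (L : ℕ) [NeZero L], L₀ ≤ L → Even L →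
        let N : ℕ := 2 * ⌊(1 - δ) * (L : ℝ) ^ 2 / 2⌋₊
        let T := hubbardTorus 2 L 1 0
        let D : Matrix (Finset (Orb (FermionTorus 2 L))) (Finset (Orb (FermionTorus 2 L))) ℂ :=
          ∑ x : FermionTorus 2 L, numberOp x 0 * numberOp x 1
        let S := szSector (Λ := FermionTorus 2 L) N 0
        let e₀ : ℝ := (hubbardTorus 2 L 1 U).minEnergyOn S
        ∀ χ : ℂ[X][X], χ.Monic →
          (∀ u μ : ℂ, (χ.map (evalRingHom u)).IsRoot μ ↔ ∃ v ∈ S, v ≠ 0 ∧ (T + u • D) *ᵥ v = μ • v) →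
          (∀ u μ : ℝ, (χ.map (evalRingHom (u : ℂ))).rootMultiplicity (μ : ℂ) =
            Module.finrank ℂ ↥(S ⊓ Module.End.eigenspace (Matrix.toLin' (T + (u : ℂ) • D)) (μ : ℂ))) →
          ∀ p : ℂ[X][X], Irreducible p → p ∣ χ → (p.map (evalRingHom (U : ℂ))).IsRoot ((e₀ : ℝ) : ℂ) →
            (∃ U₀ μ₀ : ℂ, (p.map (evalRingHom U₀)).IsRoot μ₀ ∧
              (χ.map (evalRingHom U₀)).rootMultiplicity μ₀ = 1) ∨
            (∃ ε γ : ℂ, (X - C (C ε + C γ * X)) ∣ χ ∧ ((e₀ : ℝ) : ℂ) = ε + γ * (U : ℂ)))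
    (hnoj : ∀ δ ∈ Set.Ioo (0:ℝ) (1/2), ∀ U : ℝ, 0 < U →
      (∀ (L : ℕ) (u' : ℝ), (hubbardTorus 2 L 1 u').charpoly.roots.toFinset.card ≤
        (hubbardTorus 2 L 1 U).charpoly.roots.toFinset.card) →
      ∀ c : ℝ, 0 < c →
      (∃ L₀ : ℕ, ∀ (L : ℕ) [NeZero L], L₀ ≤ L → Even L →
        let N : ℕ := 2 * ⌊(1 - δ) * (L : ℝ) ^ 2 / 2⌋₊
        let H := hubbardTorus 2 L 1 U
        let S := szSector (Λ := FermionTorus 2 L) N 0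
        let E₀ := S ⊓ Module.End.eigenspace (Matrix.toLin' H) ((H.minEnergyOn S : ℝ) : ℂ)
        let P := projMatrix (E₀.map (Fock.toEuclidean (ι := Orb (FermionTorus 2 L)) :
          Fock (Orb (FermionTorus 2 L)) →ₗ[ℂ] EuclideanSpace ℂ (Finset (Orb (FermionTorus 2 L)))))
        c * (L : ℝ) ^ 4 * P.trace.re ≤
          (P * ((pairField dWaveFormFactor L)ᴴ * pairField dWaveFormFactor L)).trace.re) →
      ∃ L₀ : ℕ, ∀ (L : ℕ) [NeZero L], L₀ ≤ L → Even L →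
        let N : ℕ := 2 * ⌊(1 - δ) * (L : ℝ) ^ 2 / 2⌋₊
        ∀ γ : ℂ, ¬ ∀ ψ : Fock (Orb (FermionTorus 2 L)),
          IsGroundStateInSector (hubbardTorus 2 L 1 U) N 0 ψ →
            (∑ x : FermionTorus 2 L, numberOp x 0 * numberOp x 1 :
              Matrix (Finset (Orb (FermionTorus 2 L))) (Finset (Orb (FermionTorus 2 L))) ℂ) *ᵥ ψ =
                γ • ψ) :
    ∀ (δ U₁ U₂ c : ℝ), δ ∈ Set.Ioo (0:ℝ) (1/2) → 0 < U₁ → U₁ < U₂ → 0 < c → (∀ U ∈ Set.Ioo U₁ U₂, ∃ L₀ : ℕ, ∀ (L : ℕ) [NeZero L], L₀ ≤ L → Even L → let N : ℕ := 2 * ⌊(1 - δ) * (L : ℝ) ^ 2 / 2⌋₊; let H := Literature.MathematicalPhysics.QuantumLattice.hubbardTorus 2 L 1 U; let S := Literature.MathematicalPhysics.QuantumLattice.szSector (Λ := Literature.MathematicalPhysics.QuantumLattice.FermionTorus 2 L) N 0; let E₀ := S ⊓ Module.End.eigenspace (Matrix.toLin' H) ((H.minEnergyOn S : ℝ) : ℂ);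 let P := Literature.MathematicalPhysics.QuantumLattice.projMatrix (E₀.map (Literature.MathematicalPhysics.QuantumLattice.Fock.toEuclidean (ι := Literature.MathematicalPhysics.QuantumLattice.Orb (Literature.MathematicalPhysics.QuantumLattice.FermionTorus 2 L)) : Literature.MathematicalPhysics.QuantumLattice.Fock (Literature.MathematicalPhysics.QuantumLattice.Orb (Literature.MathematicalPhysics.QuantumLattice.FermionTorus 2 L)) →ₗ[ℂ] EuclideanSpace ℂ (Finset (Literature.MathematicalPhysics.QuantumLattice.Orb (Literature.MathematicalPhysics.QuantumLattice.FermionTorus 2 L))))); c * (L : ℝ) ^ 4 * P.trace.re ≤ (P * (Matrix.conjTranspose (Literature.MathematicalPhysics.QuantumLattice.pairField Literature.MathematicalPhysics.QuantumLattice.dWaveFormFactor L) * Literature.MathematicalPhysics.QuantumLattice.pairField Literature.MathematicalPhysics.QuantumLattice.dWaveFormFactor L)).trace.re) → ∃ U ∈ Set.Ioo U₁ U₂, ∀ (N : ℕ → ℕ) (ψ : ∀ L, Literature.MathematicalPhysics.QuantumLattice.Fock (Literature.MathematicalPhysics.QuantumLattice.Orb (Literature.MathematicalPhysics.QuantumLattice.FermionTorus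 2 L))), (∀ L, Even L → N L = 2 * ⌊(1 - δ) * (L : ℝ) ^ 2 / 2⌋₊ ∧ star (ψ L) ⬝ᵥ ψ L = 1 ∧ Literature.MathematicalPhysics.QuantumLattice.IsGroundStateInSector (Literature.MathematicalPhysics.QuantumLattice.hubbardTorus 2 L 1 U) (N L) 0 (ψ L)) → Literature.Probability.LatticeModels.HasLongRangeOrder (fun k => Literature.Probability.LatticeModels.halfOpenBox 2 (2 * k)) (fun k => Literature.MathematicalPhysics.QuantumLattice.torusPullback (Literature.MathematicalPhysics.QuantumLattice.pairFieldCorr Literature.MathematicalPhysics.QuantumLattice.dWaveFormFactor ψ) (2 * k)) :=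
  birEveryGroundState_structural_of_uniqueGroundUnderAvg
    (uniqueGroundUnderAvg_of_reshapedSpectralCurveStubs hanch hnoj)

end Summit.HubbardSuperconductivity.HubbardSuperconductivity.Theorems
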